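import Summits.Ventures.HSemireg.WedgeHankelRecurrenceGaussLaguerreLipschitz

/-!
# Venture HSemireg — **SCHUR'S PRODUCT FOR QUASI-ORTHOGONAL (RADAU-TYPE) POLYNOMIALS**: for every scalar `c`, the quasi-orthogonal polynomial `R = q_{t+1} + c q_t` has the SAME resultant
# with `q_t` as `q_{t+1}`: **`Res_{(t+1,t)}(q_{t+1} + c q_t, q_t) = ∏_{k<t} (−b_{k+1})^{k+1}`** (any commutative ring), hence at the zeros `y_k` of `R = ∏ (X − y_k)` (e.g. Gauss–Radau nodes)
# **`∏_k q_t(y_k) = (−1)^{t(t+1)∕2} ∏_{j<t} b_{j+1}^{j+1}`** exactly as for the Gauss nodes (N403), and `q_t(y_k) ≠ 0` when `b ≠ 0` over a field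

HONEST FRAMING. Part of the Lean index of the computation cell `pub-hsemireg` (seat p10 gen 47, Sunday typer «UNIFORM-IN-n»).  Polynomial algebra (Mathlib `Polynomial.resultant`) only; no variety,
no cohomology theory, no sheaf, no Ext group and no semiregularity map is constructed here; nothing here says that HC / HC_CM / HC_AV holds; no Literature fact (unproved `Prop`) is declared or
used.  Custodian versions as in `WedgeHankelSiegelIdeal` (1/3).
SOURCES (cited).  I. Schur, J. reine angew. Math. 165 (1931) 52–58, §1; T. S. Chihara, *An Introduction to Orthogonal Polynomials* (1978), Ch. I §5 ∕ Ch. II Thm 5.2 (quasi-orthogonal polynomials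
`p_{n+1} + c p_n`, Radau); M. Riesz (1923) ∕ J. A. Shohat (1937) on quasi-orthogonality (via Chihara).  The resultant statement is a COROLLARY typed here of Schur's theorem (invariance of the
resultant under `f ↦ f + c g`); no separate printed locator is claimed.
PROOF TYPED HERE.  Mathlib `resultant_add_mul_left` (`Res(f + g·C c, g) = Res(f, g)`, degrees `deg(C c) + t ≤ t + 1`), N403 `schur_resultant` ∕ `prod_neg_pow_succ_eq`; the zero form by
`resultant_prod_left` + `resultant_X_sub_C_left` as in N403.
DEDUP DISCLOSURE (`rg -n -i 'quasi.*resultant|radau.*prod_eval' Summits/Ventures/HSemireg/WedgeHankelRecurrenceGauss*`, 2026-09-04): N3xx QuasiOrthogonal ∕ Radau leaves treat zeros and weights,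
not resultants; 0 hits for the 3 names below.

WHAT IS IN THE TREE.  N403 `schur_resultant`, `prod_neg_pow_succ_eq`, `recurrence_natDegree_le_coeff`; Mathlib `resultant_add_mul_left`, `resultant_prod_left`, `resultant_X_sub_C_left`.
THIS FILE (namespace `Summit.Ventures.HSemireg.Wedge.HankelOuter` continued; CHAINED on N424 (import only); 0 definitions):
* §1190 **`quasi_resultant`** (`Res_{(t+1,t)}(q_{t+1} + C c · q_t, q_t) = ∏ (−b_{k+1})^{k+1}`), **`prod_eval_pred_at_quasi_zeros`** (`∏_k q_t(y_k) = (−1)^{t(t+1)∕2} ∏ b_{j+1}^{j+1}`),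
  `eval_pred_ne_zero_at_quasi_zeros` (field, `b ≠ 0`: `q_t(y_k) ≠ 0`).
CAVEATS.  Formal degrees explicit; `c` arbitrary (for `c = 0` this is N403).  Nothing Ext-side.  New names only.
-/

open Module Polynomial
open scoped Matrix Polynomial

namespace Summit.Ventures.HSemireg.Wedge.HankelOuter

/-! ## §1190. Schur's product at quasi-orthogonal (Radau-type) nodes -/

/-- **`Res_{(t+1,t)}(q_{t+1} + c · q_t, q_t) = ∏_{k<t} (−b_{k+1})^{k+1}`** for every scalar `c` (any commutative ring). [corollary of Schur 1931 §1; this file, §1190] -/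
theorem quasi_resultant {R : Type*} [CommRing R] {q : ℕ → R[X]} {a b : ℕ → R} (hq0 : q 0 = 1) (hq1 : q 1 = Polynomial.X - C (a 0))
    (hrec : ∀ n, q (n + 2) = (Polynomial.X - C (a (n + 1))) * q (n + 1) - C (b (n + 1)) * q n) (c : R) (t : ℕ) :
    (q (t + 1) + C c * q t).resultant (q t) (t + 1) t = ∏ k ∈ Finset.range t, (-b (k + 1)) ^ (k + 1) := by
  obtain ⟨hdt, -⟩ := recurrence_natDegree_le_coeff hq0 hq1 hrec t
  rw [show q (t + 1) + C c * q t = q (t + 1) + q t * C c by ring, resultant_add_mul_left _ _ _ _ _ (by rw [natDegree_C]; omega) hdt, schur_resultant hq0 hq1 hrec t]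

/-- **SCHUR'S PRODUCT AT QUASI-ORTHOGONAL NODES: if `q_{t+1} + c q_t = ∏_k (X − y_k)` over a field, then `∏_k q_t(y_k) = (−1)^{t(t+1)∕2} ∏_{j<t} b_{j+1}^{j+1}`** (same value as at the Gauss
nodes). [corollary of Schur 1931 §1; Chihara II Thm 5.2 (Radau nodes); this file, §1190] -/
theorem prod_eval_pred_at_quasi_zeros {K : Type*} [Field K] {q : ℕ → K[X]} {a b : ℕ → K} (hq0 : q 0 = 1) (hq1 : q 1 = Polynomial.X - C (a 0))
    (hrec : ∀ n, q (n + 2) = (Polynomial.X - C (a (n + 1))) * q (n + 1) - C (b (n + 1)) * q n) {c : K} {t : ℕ} {y : Fin (t + 1) → K}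
    (hy : q (t + 1) + C c * q t = ∏ k, (Polynomial.X - C (y k))) :
    ∏ k, (q t).eval (y k) = (-1) ^ (t * (t + 1) / 2) * ∏ j ∈ Finset.range t, b (j + 1) ^ (j + 1) := by
  obtain ⟨hdt, -⟩ := recurrence_natDegree_le_coeff hq0 hq1 hrec t
  have h := quasi_resultant hq0 hq1 hrec c t
  rw [hy, prod_neg_pow_succ_eq] at h
  rw [← h]
  have hlc : ∏ i ∈ (Finset.univ : Finset (Fin (t + 1))), (Polynomial.X - C (y i)).leadingCoeff ≠ 0 := by
    rw [Finset.prod_eq_one fun i _ => leadingCoeff_X_sub_C (y i)]; exact one_ne_zero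
  have key := resultant_prod_left Finset.univ (fun k => Polynomial.X - C (y k)) (q t) t hlc hdt
  rw [natDegree_finsetProd_X_sub_C_eq_card, Finset.card_univ, Fintype.card_fin] at key
  rw [key]
  exact Finset.prod_congr rfl fun k _ => by rw [natDegree_X_sub_C, resultant_X_sub_C_left _ _ _ hdt]

/-- **At quasi-orthogonal nodes `q_t` does not vanish** (`b_1, …, b_t ≠ 0`, any field). [Chihara II Thm 5.2; this file, §1190] -/
theorem eval_pred_ne_zero_at_quasi_zeros {K : Type*} [Field K] {q : ℕ → K[X]} {a b : ℕ → K} (hq0 : q 0 = 1) (hq1 : q 1 = Polynomial.X - C (a 0))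
    (hrec : ∀ n, q (n + 2) = (Polynomial.X - C (a (n + 1))) * q (n + 1) - C (b (n + 1)) * q n) {c : K} {t : ℕ} {y : Fin (t + 1) → K}
    (hy : q (t + 1) + C c * q t = ∏ k, (Polynomial.X - C (y k))) (hb : ∀ k, k < t → b (k + 1) ≠ 0) (k : Fin (t + 1)) : (q t).eval (y k) ≠ 0 := by
  have h := prod_eval_pred_at_quasi_zeros hq0 hq1 hrec hy
  intro h0
  rw [Finset.prod_eq_zero (Finset.mem_univ k) h0] at h
  exact absurd h.symm (mul_ne_zero (pow_ne_zero _ (neg_ne_zero.2 one_ne_zero)) (Finset.prod_ne_zero_iff.2 fun j hj => pow_ne_zero _ (hb j (Finset.mem_range.1 hj))))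

end Summit.Ventures.HSemireg.Wedge.HankelOuter
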